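import Literature.Computability.Cryptography.LWEHardness
import HarnessLib
import Summits.PneNP.PneNP.Theorems.LWENotInBQP
import Summits.PneNP.PneNP.Theorems.LWEInBQP

/-!
# `LWE ∉ BQP` / `LWE ∈ BQP`: the unfoldings of the two open conjectures (pqc.S01 / pqc.S02)

Conjecture/notion split of `LWEHardness.lean` (coordinator, 2026-08-15). The vocabulary of the
`pqc` statements — the uniform quantum circuit families `UniformQCircuitFamily` (G11) with their
`searchLWESolver`, Regev's parameter regime `RegevRegime`, `IsPolyBounded`, the search functional
`SearchLWESolves` and the discretised Gaussian `discretizedGaussian` — stays in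
`Literature/Computability/Cryptography/LWEHardness.lean` (and the files it imports). The two
OPEN CONJECTURES built from it,

* **pqc.S01** `LWE ∉ BQP` — canonical at `Summit.PneNP.PneNP.LWENotInBQP`
  (`Summits/PneNP/PneNP/Theorems/LWENotInBQP.lean`, a conjecture leaf importing `LWEHardness`), and
* **pqc.S02** `LWE ∈ BQP` — canonical at `Summit.PneNP.PneNP.LWEInBQP`
  (`Summits/PneNP/PneNP/Theorems/LWEInBQP.lean`, likewise),

are obligations of our theories, not literature facts (human ruling 2026-08-15: Regev 2009, §1,
J. ACM 56(6), art. 34 = arXiv:2401.03703, p. 4, POSES the quantum hardness of lattice problems as a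
conjecture and proves neither direction; his only theorem there is the quantum reduction Thm 1.1,
vendored as `regev_lwe_to_sivp_quantum` / `regev_lwe_to_gapSVP_quantum`, pqc.S19). This file holds
the two declarations of `LWEHardness.lean` that *mention* the conjectures, restated verbatim over
the canonical leaves:

* `lweNotInBQP_iff` — unfolding of pqc.S01: for all admissible parameters and every polynomial-time
  uniform quantum circuit family the success probability is `< 2/3` for infinitely many `n`
  (`¬ ∀ᶠ` = `∃ᶠ ¬`);
* `lweInBQP_iff_not_lweNotInBQP` — pqc.S02 is literally the negation of pqc.S01 for the chosen
  quantifier shapes: exactly one of the two holds, and neither is known.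

Both are `simp only` unfoldings (theorems only; nothing here asserts or refutes either conjecture,
CONVENTIONS §4). Literature may import the two `Theorems/` files because they are conjecture LEAVES
(nothing but the `@[conjecture]` definitions); a future proof of either conjecture goes in the
sibling `Theorems/LWENotInBQPHolds.lean` / `Theorems/LWEInBQPHolds.lean`, so the leaves stay
importable and this file unaffected.

## References

* O. Regev, *On lattices, learning with errors, random linear codes, and cryptography*, J. ACM 56
  (2009), no. 6, art. 34 (arXiv:2401.03703), §1 (p. 4: the conjecture posed) and §4 (search LWE).
  [Regev2009]
* summits/fw-lwe-bqp/SUMMIT.md (the quantifier shapes of pqc.S01 / pqc.S02).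
-/

noncomputable section

open Filter Literature.Computability.Cryptography.LWE

namespace Literature.Computability.Cryptography

/-- Unfolding of **pqc.S01** `LWE ∉ BQP` (the canonical conjecture leaf
`Summit.PneNP.PneNP.LWENotInBQP`): it says that for all admissible parameters `(q, α, c₀, m)` in
Regev's regime and every polynomial-time uniform quantum circuit family `Q` the average-case
success probability of `Q` on search-`LWE_{q(n), Ψ̄_{α(n)}}` from `m n` samples is `< 2/3` for
infinitely many `n` (the negation of `SearchLWESolves … (fun _ => 2/3)`, whose threshold sits
under `∀ᶠ n in atTop`). [cite: Regev2009, §1 (arXiv:2401.03703 p. 4; conjecture posed) and §4]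
(quantifier shapes: summits/fw-lwe-bqp/SUMMIT.md) -/
theorem lweNotInBQP_iff : Summit.PneNP.PneNP.LWENotInBQP ↔
    ∀ (q : ℕ → ℕ) (α : ℕ → ℝ) (c₀ : ℕ) (m : ℕ → ℕ) (h : RegevRegime q α c₀), IsPolyBounded m →
      haveI := h.neZero
      ∀ Q : UniformQCircuitFamily, ∃ᶠ n in atTop,
        searchSuccessProb (discretizedGaussian (q n) (α n)) (m n)
          (Q.searchLWESolver n (q n) (m n)) < ENNReal.ofReal (2 / 3) := by
  simp only [Summit.PneNP.PneNP.LWENotInBQP, SearchLWESolves, not_eventually, not_le]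

/-- **pqc.S02 is the negation of pqc.S01**: `LWE ∈ BQP ↔ ¬ (LWE ∉ BQP)` for the canonical conjecture
leaves `Summit.PneNP.PneNP.LWEInBQP` / `Summit.PneNP.PneNP.LWENotInBQP` (literally, for the chosen
quantifier shapes: `∃ q α c₀ m h, IsPolyBounded m ∧ ∃ Q, SearchLWESolves …` versus
`∀ q α c₀ m h, IsPolyBounded m → ∀ Q, ¬ SearchLWESolves …`). Exactly one of the two open
conjectures holds; Regev 2009 proves neither. [cite: Regev2009, §1 (arXiv:2401.03703 p. 4)]
(summits/fw-lwe-bqp/SUMMIT.md) -/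
theorem lweInBQP_iff_not_lweNotInBQP :
    Summit.PneNP.PneNP.LWEInBQP ↔ ¬ Summit.PneNP.PneNP.LWENotInBQP := by
  simp only [Summit.PneNP.PneNP.LWEInBQP, Summit.PneNP.PneNP.LWENotInBQP, not_forall, not_not,
    exists_prop]

end Literature.Computability.Cryptography
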